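import Literature.RingTheory.MvPolynomial.Directrix
import Literature.AlgebraicGeometry.Resolution.HironakaDirectrixSpan
import HarnessLib

/-!
# Bridge: the CJS directrix `𝒯(I)` of an ideal vs. the Cossart–Piltant / Hironaka directrix
# `T(S)` of a set of polynomials

Topic: `Literature/AlgebraicGeometry/Resolution`. Two formalisations of Hironaka's directrix live
in the tree:

* `HironakaDirectrix.lean`, `HironakaDirectrixSpan.lean` (Cossart–Piltant 2008, proof of
  Prop. 4.2): for a SET `S ⊆ k[Y_1, …, Y_d]`, `directrix k S ⊆ (kᵈ)^∨` (annihilator of the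
  translation-invariance space), `τ(S) = hironakaTau k S`, `k[T'] = linearFormsSubalgebra k T'`,
  and `directrix_eq_sInf : directrix k S = sInf {T' | S ⊆ k[T']}`;
* `Literature/RingTheory/MvPolynomial/Directrix.lean` (Cossart–Jannsen–Saito 2020, Lemma 2.7,
  Def. 2.8): for an IDEAL `I`, `directrixSpace I = 𝒯(I) ⊆ S_1`, the least subspace `T` of linear
  forms such that `I` is GENERATED by `I ∩ k[T]` (`Directs I T`, `isLeast_directrixSpace`).

This file is the dictionary. Linear forms are encoded there as functionals
`ℓ ∈ Module.Dual k (Fin d → k)` with `linearFormPoly k ℓ = Σ ℓ(e_i) Y_i`, here as elements of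
`S_1 = homogeneousSubmodule (Fin d) k 1`; `linearFormPolyₗ k` is a linear isomorphism onto `S_1`
(`range_linearFormPolyₗ`, `linearFormPolyₗ_injective`) and
`k[T'.map linearFormPolyₗ] = linearFormsSubalgebra k T'` (`adjoin_map_linearFormPolyₗ`). Then:

* `directs_map_iff` — `T'` directs `I` iff `I = (S)` for some `S ⊆ k[T']`;
* **`directs_map_iff_exists_directrix_le`** — iff `I = (S)` for some `S` with `T(S) ⊆ T'`
  (by `directrix_le_of_subset` and `subset_linearFormsSubalgebra_directrix`);
* **`directrixSpace_le_map_directrix`**, **`exists_span_eq_and_directrixSpace_eq`** —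
  **`𝒯(I) = ⨅ {T(S) : (S) = I}`, attained at `S = I ∩ k[𝒯(I)]`**: `𝒯(I) ⊆ T(S)` for every
  generating set `S` of `I`, with equality for some `S`;
* `finrank_directrixSpace_le_hironakaTau`, `exists_span_eq_and_finrank_directrixSpace_eq` —
  `dim_k 𝒯(I) = min {τ(S) : (S) = I}`.

## References

* V. Cossart, U. Jannsen, S. Saito, LNM 2270 (2020), Lemma 2.7, Def. 2.8. [CossartJannsenSaito2020]
* V. Cossart, O. Piltant, J. Algebra 320 (2008), proof of Prop. 4.2. [CossartPiltant2008]
-/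

noncomputable section

open MvPolynomial Module
open Literature.RingTheory.MvPolynomial

namespace Literature.AlgebraicGeometry.Resolution

universe u

variable (k : Type u) [Field k] {d : ℕ}

/-! ## The two encodings of linear forms -/

/-- `linearFormPoly k ℓ = linForm (ℓ(e_1), …, ℓ(e_d))`. [folklore] -/
theorem linearFormPoly_eq_linForm (ℓ : Module.Dual k (Fin d → k)) :
    linearFormPoly k ℓ = linForm (fun i => ℓ (Pi.single i 1)) := by
  rw [linearFormPoly, linForm_apply]
  exact Finset.sum_congr rfl fun i _ => by rw [smul_eq_C_mul]

/-- `linearFormPolyₗ` is injective: a linear form determines the functional. [folklore] -/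
theorem linearFormPolyₗ_injective : Function.Injective (linearFormPolyₗ k (d := d)) := by
  intro ℓ ℓ' h
  rw [linearFormPolyₗ_apply, linearFormPolyₗ_apply, linearFormPoly_eq_linForm,
    linearFormPoly_eq_linForm] at h
  have h' := linForm_injective h
  refine (Pi.basisFun k (Fin d)).ext fun i => ?_
  rw [Pi.basisFun_apply]
  exact congrFun h' i

/-- The image of `linearFormPolyₗ` is the space of forms of degree `1`. [folklore] -/
theorem range_linearFormPolyₗ :
    LinearMap.range (linearFormPolyₗ k (d := d)) = homogeneousSubmodule (Fin d) k 1 := by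
  refine le_antisymm ?_ ?_
  · rintro _ ⟨ℓ, rfl⟩
    rw [linearFormPolyₗ_apply, linearFormPoly_eq_linForm]
    exact isHomogeneous_linForm _
  · rw [← range_linForm]
    rintro _ ⟨v, rfl⟩
    refine ⟨(Pi.basisFun k (Fin d)).constr k v, ?_⟩
    rw [linearFormPolyₗ_apply, linearFormPoly_eq_linForm]
    congr 1
    funext i
    rw [← Pi.basisFun_apply, Basis.constr_basis]

/-- **`k[T'] = linearFormsSubalgebra k T'` is `Algebra.adjoin` of the corresponding subspace of
`S_1`.** [folklore] -/
theorem adjoin_map_linearFormPolyₗ (T' : Submodule k (Module.Dual k (Fin d → k))) :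
    Algebra.adjoin k ((T'.map (linearFormPolyₗ k) : Submodule k (MvPolynomial (Fin d) k)) :
      Set (MvPolynomial (Fin d) k)) = linearFormsSubalgebra k T' := by
  rw [Submodule.map_coe, linearFormsSubalgebra]
  rfl

/-- Every subspace of linear forms is the image of a subspace of functionals. [folklore] -/
theorem map_comap_linearFormPolyₗ {T : Submodule k (MvPolynomial (Fin d) k)}
    (hT : T ≤ homogeneousSubmodule (Fin d) k 1) :
    (T.comap (linearFormPolyₗ k)).map (linearFormPolyₗ k) = T := by
  rw [Submodule.map_comap_eq, range_linearFormPolyₗ, inf_eq_right.mpr hT]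

/-! ## The dictionary -/

variable {k}
variable {I : Ideal (MvPolynomial (Fin d) k)} {T' : Submodule k (Module.Dual k (Fin d → k))}

/-- **`T'` directs `I` iff `I` is generated by a set of polynomials in `k[T']`.**
[cite: CossartJannsenSaito2020, Lemma 2.7] -/
theorem directs_map_iff :
    Directs I (T'.map (linearFormPolyₗ k)) ↔
      ∃ S : Set (MvPolynomial (Fin d) k), S ⊆ linearFormsSubalgebra k T' ∧ Ideal.span S = I := by
  rw [directs_iff_exists_span, adjoin_map_linearFormPolyₗ]
  have hle : T'.map (linearFormPolyₗ k) ≤ homogeneousSubmodule (Fin d) k 1 := by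
    rw [← range_linearFormPolyₗ]
    exact LinearMap.map_le_range
  exact ⟨fun h => h.2, fun h => ⟨hle, h⟩⟩

/-- **`T'` directs `I` iff `I = (S)` for a set `S` whose Hironaka/Cossart–Piltant directrix `T(S)`
is contained in `T'`** (`directrix_le_of_subset`: `S ⊆ k[T'] ⟹ T(S) ⊆ T'`;
`subset_linearFormsSubalgebra_directrix`: `S ⊆ k[T(S)]`). [cite: CossartJannsenSaito2020, Lemma 2.7] -/
theorem directs_map_iff_exists_directrix_le :
    Directs I (T'.map (linearFormPolyₗ k)) ↔
      ∃ S : Set (MvPolynomial (Fin d) k), Ideal.span S = I ∧ directrix k S ≤ T' := by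
  rw [directs_map_iff]
  constructor
  · rintro ⟨S, hS, hSI⟩
    exact ⟨S, hSI, directrix_le_of_subset k hS⟩
  · rintro ⟨S, hSI, hST⟩
    refine ⟨S, (subset_linearFormsSubalgebra_directrix k S).trans ?_, hSI⟩
    exact Algebra.adjoin_mono (Set.image_mono hST)

/-- **`𝒯(I) ⊆ T(S)` for every generating set `S` of `I`.** [cite: CossartJannsenSaito2020, Lemma 2.7] -/
theorem directrixSpace_le_map_directrix {S : Set (MvPolynomial (Fin d) k)} (hS : Ideal.span S = I) :
    directrixSpace I ≤ (directrix k S).map (linearFormPolyₗ k) :=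
  directrixSpace_le (directs_map_iff_exists_directrix_le.mpr ⟨S, hS, le_rfl⟩)

variable (k I) in
/-- **`𝒯(I) = T(S)` for some generating set `S` of `I`** (e.g. `S = I ∩ k[𝒯(I)]`): with the previous
lemma, `𝒯(I) = ⨅ {T(S) : (S) = I}` and the infimum is attained — CJS Lemma 2.7 in the language of
`HironakaDirectrix.lean`. [cite: CossartJannsenSaito2020, Lemma 2.7] -/
theorem exists_span_eq_and_directrixSpace_eq :
    ∃ S : Set (MvPolynomial (Fin d) k), Ideal.span S = I ∧
      directrixSpace I = (directrix k S).map (linearFormPolyₗ k) := by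
  set T' := (directrixSpace I).comap (linearFormPolyₗ k) with hT'
  have hmap : T'.map (linearFormPolyₗ k) = directrixSpace I :=
    map_comap_linearFormPolyₗ k (directrixSpace_le_one I)
  have hd : Directs I (T'.map (linearFormPolyₗ k)) := by
    rw [hmap]
    exact directs_directrixSpace I
  obtain ⟨S, hSI, hST⟩ := directs_map_iff_exists_directrix_le.mp hd
  refine ⟨S, hSI, le_antisymm (directrixSpace_le_map_directrix hSI) ?_⟩
  rw [← hmap]
  exact Submodule.map_mono hST

/-- `dim_k T(S)` is preserved by the encoding. [folklore] -/
theorem finrank_map_directrix (S : Set (MvPolynomial (Fin d) k)) :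
    Module.finrank k ((directrix k S).map (linearFormPolyₗ k)) = hironakaTau k S :=
  (LinearEquiv.finrank_eq
    (Submodule.equivMapOfInjective _ (linearFormPolyₗ_injective k) (directrix k S))).symm

/-- **`dim_k 𝒯(I) ≤ τ(S)` for every generating set `S` of `I`.** [cite: CossartJannsenSaito2020, Lemma 2.7] -/
theorem finrank_directrixSpace_le_hironakaTau {S : Set (MvPolynomial (Fin d) k)}
    (hS : Ideal.span S = I) : Module.finrank k (directrixSpace I) ≤ hironakaTau k S := by
  rw [← finrank_map_directrix]
  haveI : FiniteDimensional k ((directrix k S).map (linearFormPolyₗ k)) :=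
    Module.Finite.map _ _
  exact Submodule.finrank_mono (directrixSpace_le_map_directrix hS)

variable (k I) in
/-- **`dim_k 𝒯(I) = τ(S)` for some generating set `S` of `I`**, so `dim_k 𝒯(I) = min {τ(S) : (S) = I}`
and `e(S/I) = d - min τ(S)`. [cite: CossartJannsenSaito2020, Def. 2.8] -/
theorem exists_span_eq_and_finrank_directrixSpace_eq :
    ∃ S : Set (MvPolynomial (Fin d) k), Ideal.span S = I ∧
      Module.finrank k (directrixSpace I) = hironakaTau k S := by
  obtain ⟨S, hS, heq⟩ := exists_span_eq_and_directrixSpace_eq k I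
  exact ⟨S, hS, by rw [heq, finrank_map_directrix]⟩

end Literature.AlgebraicGeometry.Resolution

end
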